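import Literature.NumberTheory.EllipticCurves.NonsplitPoints
import Literature.NumberTheory.EllipticCurves.NonsplitNormalForm
import Literature.NumberTheory.EllipticCurves.NeronComponentIndex
import Literature.NumberTheory.EllipticCurves.TamagawaSubgroupProofs
import Mathlib.FieldTheory.ChevalleyWarning
import HarnessLib

/-!
# The local index for non-split multiplicative reduction: `c_v ∈ {1, 2}` by parity (proof)

Discharge of the named fact
`Literature.NumberTheory.EllipticCurves.localTamagawaNumber_of_hasNonsplitMultiplicativeReductionAt`
(`NeronComponentIndex.lean`; Silverman, *ATAEC*, IV.9.4 Step 2, PDF p. 344: for multiplicative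
reduction with `T² + a₁T − a₂` irreducible over `k`, "`c = 1` if `v(Δ)` is odd, `c = 2` if
`v(Δ)` is even", `k` finite), elementarily:

1. bring the integral local minimal model to the non-split normal form `J`
   (`exists_smul_nonsplitNormalForm`: `a₃ = a₄ = 0`, `a₆ = απᵐ` with `m = ord_v(Δ_min)` since
   `Δ = −a₆(b₂³ + 432a₆)`, anisotropic tangent form);
2. any two bad points add up into `E₀` (`hasNonsingularReduction_add_of_anisotropic`), so the
   index is `1` or `2` according as a bad point exists;
3. `m` odd: no bad point (`not_equation_of_odd`); `m = 2h` even: a bad point `(πʰx', πʰy')`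
   exists (`exists_equation_of_even`): a solution of `ȳ² + ā₁x̄ȳ − ā₂x̄² = ᾱ` over the finite
   field `k` exists by the Chevalley–Warning theorem applied to the ternary quadratic form
   `Y² + ā₁XY − ā₂X² − ᾱZ²` (a non-trivial zero has `Z ≠ 0` by anisotropy), and it lifts by
   Hensel's lemma in the variable whose partial derivative is a unit (not both vanish, as
   `b₂ = a₁² + 4a₂ ∈ Rˣ`).

## References

* J. H. Silverman, *Advanced Topics in the Arithmetic of Elliptic Curves*, GTM 151, Springer
  1994, IV.9.4 Step 2 (PDF p. 344), Rem. IV.9.3 (PDF p. 341). [SilvermanATAEC1994]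
-/

noncomputable section

open scoped Classical

open IsLocalRing Polynomial

namespace Literature.NumberTheory.EllipticCurves

namespace LocalIndex

open DiophantineGeometry DiophantineGeometry.TateAlgorithm

variable {R : Type*} [CommRing R] [IsDomain R] [IsDiscreteValuationRing R]

/-! ### A bad point exists when `v(a₆)` is even and `k` is finite -/

/-- **A rational point on the conic `Y² + ā₁XY − ā₂X² = ᾱ` over a finite field** when the
binary form `Y² + ā₁XY − ā₂X²` is anisotropic: by the Chevalley–Warning theorem
the ternary quadratic form `Y² + ā₁XY − ā₂X² − ᾱZ²` has a non-trivial zero, and `Z ≠ 0` by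
anisotropy. [folklore] -/
theorem exists_conic_point {k : Type*} [Field k] [Finite k] (a b c : k)
    (hani : ∀ τ : k, τ ^ 2 + a * τ - b ≠ 0) : ∃ x y : k, y ^ 2 + a * x * y - b * x ^ 2 = c := by
  haveI := Fintype.ofFinite k
  set F : MvPolynomial (Fin 3) k := MvPolynomial.X 1 ^ 2 +
    MvPolynomial.C a * MvPolynomial.X 0 * MvPolynomial.X 1 -
    MvPolynomial.C b * MvPolynomial.X 0 ^ 2 - MvPolynomial.C c * MvPolynomial.X 2 ^ 2 with hF
  have hev : ∀ z : Fin 3 → k, MvPolynomial.eval z F =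
      z 1 ^ 2 + a * z 0 * z 1 - b * z 0 ^ 2 - c * z 2 ^ 2 := by
    intro z; simp [hF]
  have hdeg : F.totalDegree < Fintype.card (Fin 3) := by
    rw [Fintype.card_fin]
    have hX2 : ∀ i : Fin 3, (MvPolynomial.X i ^ 2 : MvPolynomial (Fin 3) k).totalDegree ≤ 2 :=
      fun i => (MvPolynomial.totalDegree_X_pow i 2).le
    have hC : ∀ (r : k) (f : MvPolynomial (Fin 3) k), f.totalDegree ≤ 2 →
        (MvPolynomial.C r * f).totalDegree ≤ 2 := fun r f hf =>
      (MvPolynomial.totalDegree_mul _ _).trans (by rw [MvPolynomial.totalDegree_C, zero_add]; exact hf)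
    have hmid : (MvPolynomial.C a * MvPolynomial.X 0 * MvPolynomial.X 1 :
        MvPolynomial (Fin 3) k).totalDegree ≤ 2 := by
      refine (MvPolynomial.totalDegree_mul _ _).trans ?_
      have h0 : (MvPolynomial.C a * MvPolynomial.X 0 : MvPolynomial (Fin 3) k).totalDegree ≤ 1 :=
        (MvPolynomial.totalDegree_mul _ _).trans (by
          rw [MvPolynomial.totalDegree_C, zero_add]; exact (MvPolynomial.totalDegree_X _).le)
      have h1 : (MvPolynomial.X 1 : MvPolynomial (Fin 3) k).totalDegree ≤ 1 :=
        (MvPolynomial.totalDegree_X _).le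
      omega
    refine Nat.lt_succ_of_le ((MvPolynomial.totalDegree_sub _ _).trans (max_le
      ((MvPolynomial.totalDegree_sub _ _).trans (max_le ((MvPolynomial.totalDegree_add _ _).trans
        (max_le (hX2 1) hmid)) (hC b _ (hX2 0)))) (hC c _ (hX2 2))))
  have hdvd := char_dvd_card_solutions (ringChar k) hdeg
  have hp : (ringChar k).Prime := CharP.char_is_prime k (ringChar k)
  -- a non-trivial zero
  have hcard : 1 < Fintype.card {z : Fin 3 → k // MvPolynomial.eval z F = 0} := by
    have hpos : 0 < Fintype.card {z : Fin 3 → k // MvPolynomial.eval z F = 0} :=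
      Fintype.card_pos_iff.mpr ⟨⟨0, by rw [hev]; simp⟩⟩
    exact lt_of_lt_of_le hp.one_lt (Nat.le_of_dvd hpos hdvd)
  obtain ⟨⟨z, hz⟩, hz0⟩ := Fintype.exists_ne_of_one_lt_card hcard ⟨0, by rw [hev]; simp⟩
  rw [hev] at hz
  have hz2 : z 2 ≠ 0 := by
    intro h2
    apply hz0
    rw [h2] at hz
    have hz0' : z 0 = 0 := by
      by_contra h0
      apply hani (z 1 / z 0)
      field_simp
      linear_combination hz
    have hz1 : z 1 = 0 := by
      rw [hz0'] at hz
      exact pow_eq_zero_iff two_ne_zero |>.mp (by linear_combination hz)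
    ext i; fin_cases i <;> simp [hz0', hz1, h2]
  refine ⟨z 0 / z 2, z 1 / z 2, ?_⟩
  field_simp
  linear_combination hz

/-- **A bad point exists when `v(a₆) = 2h` is even** (non-split normal form over a Henselian
discrete valuation ring with finite residue field): a point `(x̄', ȳ')` of the conic
`Y² + ā₁XY − ā₂X² = ᾱ` (`exists_conic_point`) lifts by Hensel's lemma — in `y'` if
`2ȳ' + ā₁x̄' ≠ 0`, else in `x'` (then `ā₁ȳ' − 2ā₂x̄' ≠ 0` since `b₂ ∈ Rˣ`) — to a solution of
`y'² + a₁x'y' − a₂x'² = πʰx'³ + α`, and `(πʰx', πʰy')` is a point of `J` reducing to the node.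
This is "`c = 2` if `v(Δ)` is even" of Silverman, *ATAEC*, IV.9.4 Step 2.
[cite: SilvermanATAEC1994, IV.9.4 Step 2] -/
theorem exists_equation_of_even [HenselianLocalRing R] [Finite (ResidueField R)]
    (J : WeierstrassCurve R) {ϖ : R} (hϖ : Irreducible ϖ) (h3 : J.a₃ = 0) (h4 : J.a₄ = 0)
    {α : R} (hα : IsUnit α) {h : ℕ} (hh : 1 ≤ h) (h6 : J.a₆ = α * ϖ ^ (2 * h))
    (hani : ∀ τ : ResidueField R, τ ^ 2 + residue R J.a₁ * τ - residue R J.a₂ ≠ 0)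
    (hb₂ : IsUnit J.b₂) :
    ∃ x y : R, x ∈ maximalIdeal R ∧ y ∈ maximalIdeal R ∧ J.toAffine.Equation x y := by
  have hm : ϖ ∈ maximalIdeal R := (IsLocalRing.mem_maximalIdeal _).mpr hϖ.not_isUnit
  have hmh : ϖ ^ h ∈ maximalIdeal R := Ideal.pow_mem_of_mem _ hm h hh
  have hres0 : residue R (ϖ ^ h) = 0 := (residue_eq_zero_iff _).mpr hmh
  have hrα : residue R α ≠ 0 := (isUnit_iff_residue_ne_zero α).mp hα
  obtain ⟨X, Y, hXY⟩ := exists_conic_point (residue R J.a₁) (residue R J.a₂) (residue R α) hani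
  obtain ⟨X₀, rfl⟩ := residue_surjective X
  obtain ⟨Y₀, rfl⟩ := residue_surjective Y
  -- the equation to solve and its reduction to a point of `J`
  have key : ∀ x' y' : R, y' ^ 2 + J.a₁ * x' * y' - J.a₂ * x' ^ 2 - ϖ ^ h * x' ^ 3 - α = 0 →
      ∃ x y : R, x ∈ maximalIdeal R ∧ y ∈ maximalIdeal R ∧ J.toAffine.Equation x y := by
    intro x' y' hG
    refine ⟨ϖ ^ h * x', ϖ ^ h * y', Ideal.mul_mem_right _ _ hmh, Ideal.mul_mem_right _ _ hmh, ?_⟩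
    rw [WeierstrassCurve.Affine.equation_iff, h3, h4, h6, pow_mul]
    linear_combination (ϖ ^ h) ^ 2 * hG
  by_cases hY : IsUnit (2 * Y₀ + J.a₁ * X₀)
  · -- Hensel in `y'`
    set g : R[X] := X ^ 2 + C (J.a₁ * X₀) * X + C (-(J.a₂ * X₀ ^ 2) - ϖ ^ h * X₀ ^ 3 - α)
      with hg
    have hmonic : g.Monic := by rw [hg]; monicity!
    have hev : ∀ y, g.eval y = y ^ 2 + J.a₁ * X₀ * y - J.a₂ * X₀ ^ 2 - ϖ ^ h * X₀ ^ 3 - α := by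
      intro y; simp [hg]; ring
    have h₁ : g.eval Y₀ ∈ maximalIdeal R := by
      rw [hev, ← residue_eq_zero_iff]
      simp only [map_sub, map_add, map_pow, map_mul, hres0, zero_mul]
      linear_combination hXY
    have h₂ : IsUnit (g.derivative.eval Y₀) := by
      have : g.derivative.eval Y₀ = 2 * Y₀ + J.a₁ * X₀ := by
        simp only [hg, derivative_add, derivative_X_pow, Nat.cast_ofNat, derivative_mul,
          derivative_C, zero_mul, derivative_X, mul_one, zero_add, add_zero, eval_add, eval_mul,
          eval_pow, eval_X, eval_C]
        ring
      rw [this]; exact hY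
    obtain ⟨y', hy', -⟩ := HenselianLocalRing.is_henselian g hmonic Y₀ h₁ h₂
    exact key X₀ y' (by rw [← hev]; exact hy')
  · -- Hensel in `x'`: the other partial derivative is a unit
    have hX : IsUnit (J.a₁ * Y₀ - 2 * J.a₂ * X₀) := by
      refine IsLocalRing.notMem_maximalIdeal.mp fun hXm => ?_
      have hYm : 2 * Y₀ + J.a₁ * X₀ ∈ maximalIdeal R := (IsLocalRing.mem_maximalIdeal _).mpr hY
      have hb₂def : J.b₂ = J.a₁ ^ 2 + 4 * J.a₂ := rfl
      have hX₀ : X₀ ∈ maximalIdeal R := by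
        have e : J.b₂ * X₀ = J.a₁ * (2 * Y₀ + J.a₁ * X₀) - 2 * (J.a₁ * Y₀ - 2 * J.a₂ * X₀) := by
          rw [hb₂def]; ring
        have : J.b₂ * X₀ ∈ maximalIdeal R :=
          e ▸ Ideal.sub_mem _ (Ideal.mul_mem_left _ _ hYm) (Ideal.mul_mem_left _ _ hXm)
        exact (Ideal.unit_mul_mem_iff_mem _ hb₂).mp this
      have hY₀ : Y₀ ∈ maximalIdeal R := by
        have e : J.b₂ * Y₀ = J.a₁ * (J.a₁ * Y₀ - 2 * J.a₂ * X₀) + 2 * J.a₂ * (2 * Y₀ + J.a₁ * X₀) := by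
          rw [hb₂def]; ring
        have : J.b₂ * Y₀ ∈ maximalIdeal R :=
          e ▸ Ideal.add_mem _ (Ideal.mul_mem_left _ _ hXm) (Ideal.mul_mem_left _ _ hYm)
        exact (Ideal.unit_mul_mem_iff_mem _ hb₂).mp this
      apply hrα
      rw [← hXY, (residue_eq_zero_iff _).mpr hX₀, (residue_eq_zero_iff _).mpr hY₀]; ring
    set f : R[X] := C (-(ϖ ^ h)) * X ^ 3 + C (-J.a₂) * X ^ 2 + C (J.a₁ * Y₀) * X +
      C (Y₀ ^ 2 - α) with hf
    have hev : ∀ x, f.eval x = Y₀ ^ 2 + J.a₁ * x * Y₀ - J.a₂ * x ^ 2 - ϖ ^ h * x ^ 3 - α := by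
      intro x; simp [hf]; ring
    have h₁ : f.eval X₀ ∈ maximalIdeal R := by
      rw [hev, ← residue_eq_zero_iff]
      simp only [map_sub, map_add, map_pow, map_mul, hres0, zero_mul]
      linear_combination hXY
    have h₂ : IsUnit (f.derivative.eval X₀) := by
      have : f.derivative.eval X₀ = (J.a₁ * Y₀ - 2 * J.a₂ * X₀) + ϖ * (-(3 * ϖ ^ (h - 1) * X₀ ^ 2)) := by
        have hh' : ϖ ^ h = ϖ * ϖ ^ (h - 1) := by rw [← pow_succ']; congr 1; omega
        simp only [hf, derivative_add, derivative_mul, derivative_C, zero_mul, derivative_X_pow,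
          Nat.cast_ofNat, zero_add, derivative_X, mul_one, eval_add, eval_mul, eval_C,
          eval_pow, eval_X, add_zero]
        rw [hh']; ring
      rw [this]; exact isUnit_add_mul_of_isUnit hϖ hX _
    obtain ⟨x', hx', -⟩ := HenselianLocalRing.exists_isRoot_of_isUnit_derivative f X₀ h₁ h₂
    exact key x' Y₀ (by rw [← hev]; exact hx'.eq_zero)

/-! ### The index of the normal form -/

variable {K : Type*} [Field K] [Algebra R K] [IsFractionRing R K]

/-- **`[E(K) : E₀(K)]` for the non-split normal form**: `2` if `v(a₆)` is even, `1` if odd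
(`a₃ = a₄ = 0`, `a₆ = απᵐ`, `α ∈ Rˣ`, `m ≥ 1`, `b₂ ∈ Rˣ`, anisotropic tangent form, `Δ ≠ 0`;
Henselian `R` with finite residue field). [cite: SilvermanATAEC1994, IV.9.4 Step 2] -/
theorem index_of_nonsplitNormalForm [HenselianLocalRing R] [Finite (ResidueField R)]
    (J : WeierstrassCurve R) {ϖ : R} (hϖ : Irreducible ϖ) (hΔ : J.Δ ≠ 0) (h3 : J.a₃ = 0)
    (h4 : J.a₄ = 0) {α : R} (hα : IsUnit α) {m : ℕ} (hm : 1 ≤ m) (h6 : J.a₆ = α * ϖ ^ m)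
    (hani : ∀ τ : ResidueField R, τ ^ 2 + residue R J.a₁ * τ - residue R J.a₂ ≠ 0)
    (hb₂ : IsUnit J.b₂) :
    (J.nonsingularReductionSubgroup (integers_valuationRing_valuation R K)).index =
      if Even m then 2 else 1 := by
  have hinj := IsFractionRing.injective R K
  set H := J.nonsingularReductionSubgroup (integers_valuationRing_valuation R K) with hH
  have hmϖ : ϖ ∈ maximalIdeal R := (IsLocalRing.mem_maximalIdeal _).mpr hϖ.not_isUnit
  have h3m : J.a₃ ∈ maximalIdeal R := h3 ▸ Ideal.zero_mem _
  have h4m : J.a₄ ∈ maximalIdeal R := h4 ▸ Ideal.zero_mem _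
  have h6m : J.a₆ ∈ maximalIdeal R :=
    h6 ▸ Ideal.mul_mem_left _ _ (Ideal.pow_mem_of_mem _ hmϖ m hm)
  -- two bad points add up into `E₀`
  have hadd : ∀ P Q, P ∉ H → Q ∉ H → P + Q ∈ H := by
    intro P Q hP hQ
    rw [hH, WeierstrassCurve.mem_nonsingularReductionSubgroup_iff] at hP hQ ⊢
    obtain ⟨x₁, y₁, h₁, rfl, hx₁, -⟩ :=
      exists_eq_some_of_not_hasNonsingularReduction J h3m h4m h6m hP
    obtain ⟨x₂, y₂, h₂, rfl, hx₂, -⟩ :=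
      exists_eq_some_of_not_hasNonsingularReduction J h3m h4m h6m hQ
    exact hasNonsingularReduction_add_of_anisotropic J h3m h4m h6m hani hx₁ hx₂ h₁ h₂
  split_ifs with heven
  · -- `m` even: a bad point exists
    obtain ⟨h, rfl⟩ := heven
    rw [← two_mul] at h6 hm
    obtain ⟨x, y, hx, hy, he⟩ :=
      exists_equation_of_even J hϖ h3 h4 hα (by omega) h6 hani hb₂
    have hΔK : (J.baseChange K).Δ ≠ 0 := by
      rw [WeierstrassCurve.baseChange, WeierstrassCurve.map_Δ]
      exact (map_ne_zero_iff _ hinj).mpr hΔ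
    have hns := (WeierstrassCurve.Affine.equation_iff_nonsingular_of_Δ_ne_zero hΔK).mp
      ((WeierstrassCurve.Affine.map_equation _ hinj x y).mpr he)
    refine index_eq_two_of_forall_add_mem H (P₀ := .some _ _ hns) ?_ hadd
    rw [hH, WeierstrassCurve.mem_nonsingularReductionSubgroup_iff]
    exact not_hasNonsingularReduction_some J h3m h4m hx hy hns
  · -- `m` odd: no bad point
    rw [AddSubgroup.index_eq_one, eq_top_iff]
    intro P _
    rw [hH, WeierstrassCurve.mem_nonsingularReductionSubgroup_iff]
    by_contra hP
    obtain ⟨x, y, h, rfl, hx, -⟩ :=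
      exists_eq_some_of_not_hasNonsingularReduction J h3m h4m h6m hP
    exact not_equation_of_odd J hϖ h3 h4 hα (Nat.not_even_iff_odd.mp heven) h6 hani hx
      ((WeierstrassCurve.Affine.map_equation _ hinj x y).mp h.left)

/-- **`[E(K) : E₀(K)]` for a non-split multiplicative equation** over a Henselian discrete
valuation ring with finite residue field: `2` if `v(Δ)` is even, `1` if odd, for any `R`-model
`I` with `Δ ≠ 0`, `Δ ∈ 𝔪`, `c₄ ∉ 𝔪` whose reduction has a node-tangent polynomial without roots
in `k` (normal form, `Δ = −a₆(b₂³ + 432a₆)`, and `index_of_nonsplitNormalForm`).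
[cite: SilvermanATAEC1994, IV.9.4 Step 2] -/
theorem index_of_nonsplit [HenselianLocalRing R] [Finite (ResidueField R)]
    (I : WeierstrassCurve R) (hΔ0 : I.Δ ≠ 0) (hΔ : I.Δ ∈ maximalIdeal R)
    (hc₄ : I.c₄ ∉ maximalIdeal R)
    (hns : ∀ μ : ResidueField R, (I.map (residue R)).c₄ * μ ^ 2 +
      (I.map (residue R)).a₁ * (I.map (residue R)).c₄ * μ -
        (54 * (I.map (residue R)).b₆ - 3 * (I.map (residue R)).b₂ * (I.map (residue R)).b₄ +
          (I.map (residue R)).a₂ * (I.map (residue R)).c₄) ≠ 0) :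
    (I.nonsingularReductionSubgroup (integers_valuationRing_valuation R K)).index =
      if Even (IsDiscreteValuationRing.addVal R I.Δ).toNat then 2 else 1 := by
  have hϖ : Irreducible (uniformizer R) := irreducible_uniformizer
  set ϖ := uniformizer R with hϖdef
  obtain ⟨D, h3, h4, h6, hb₂, hani⟩ := exists_smul_nonsplitNormalForm I hΔ hc₄ hns
  set J := D • I with hJ
  -- `Δ_J = -a₆ (b₂³ + 432 a₆)`, so `v(a₆) = v(Δ_J) = v(Δ_I)`
  have hΔJ : J.Δ = -(J.a₆ * (J.b₂ ^ 3 + 432 * J.a₆)) := by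
    simp only [WeierstrassCurve.Δ, WeierstrassCurve.b₂, WeierstrassCurve.b₄,
      WeierstrassCurve.b₆, WeierstrassCurve.b₈, h3, h4]
    ring
  have hΔJ' : J.Δ = ((D.u⁻¹ : Rˣ) : R) ^ 12 * I.Δ := WeierstrassCurve.variableChange_Δ _ _
  have hJΔ0 : J.Δ ≠ 0 := by
    rw [hΔJ']; exact mul_ne_zero (pow_ne_zero _ (Units.ne_zero _)) hΔ0
  have hu432 : IsUnit (J.b₂ ^ 3 + 432 * J.a₆) := by
    obtain ⟨c, hc⟩ := (mem_maximalIdeal_iff_dvd_of_irreducible hϖ _).mp h6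
    rw [hc, show J.b₂ ^ 3 + 432 * (ϖ * c) = J.b₂ ^ 3 + ϖ * (432 * c) by ring]
    exact isUnit_add_mul_of_isUnit hϖ (hb₂.pow 3) _
  have ha0 : J.a₆ ≠ 0 := by
    intro h0; apply hJΔ0; rw [hΔJ, h0]; ring
  obtain ⟨n, αu, hα⟩ := IsDiscreteValuationRing.eq_unit_mul_pow_irreducible ha0 hϖ
  have hval : (IsDiscreteValuationRing.addVal R I.Δ).toNat = n := by
    have e1 : IsDiscreteValuationRing.addVal R J.Δ = IsDiscreteValuationRing.addVal R I.Δ := by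
      rw [hΔJ', IsDiscreteValuationRing.addVal_mul, IsDiscreteValuationRing.addVal_pow,
        IsDiscreteValuationRing.addVal_eq_zero_iff.mpr D.u⁻¹.isUnit, nsmul_zero, zero_add]
    have e2 : IsDiscreteValuationRing.addVal R J.Δ = n := by
      rw [hΔJ, ← neg_one_mul, IsDiscreteValuationRing.addVal_mul,
        IsDiscreteValuationRing.addVal_mul,
        IsDiscreteValuationRing.addVal_eq_zero_iff.mpr isUnit_one.neg, zero_add,
        IsDiscreteValuationRing.addVal_eq_zero_iff.mpr hu432, add_zero, hα,
        IsDiscreteValuationRing.addVal_def' αu hϖ n]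
    rw [← e1, e2, ENat.toNat_coe]
  have hn1 : 1 ≤ n := by
    refine Nat.one_le_iff_ne_zero.mpr fun h0 => ?_
    rw [h0, pow_zero, mul_one] at hα
    exact (IsLocalRing.mem_maximalIdeal _).mp h6 (hα ▸ αu.isUnit)
  rw [hval, ← index_nonsingularReductionSubgroup_smul I D]
  exact index_of_nonsplitNormalForm J hϖ hJΔ0 h3 h4 αu.isUnit hn1 (by rw [hα]) hani hb₂

/-- Non-splitness in Mathlib's sense (`HasSplitMultiplicativeReduction`: the node-tangent
polynomial, of degree `2` as `c₄ ∉ 𝔪`, does not split over `k`) means that this polynomial has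
no root in `k` (`Polynomial.Splits.of_degree_eq_two`). [folklore] -/
theorem noroot_of_not_splits (I : WeierstrassCurve R) (hc₄ : I.c₄ ∉ maximalIdeal R)
    (hns : ¬ Splits (Polynomial.map (algebraMap R (ResidueField R))
      (C I.c₄ * X ^ 2 + C (I.a₁ * I.c₄) * X - C (54 * I.b₆ - 3 * I.b₂ * I.b₄ + I.a₂ * I.c₄))))
    (μ : ResidueField R) :
    (I.map (residue R)).c₄ * μ ^ 2 + (I.map (residue R)).a₁ * (I.map (residue R)).c₄ * μ -
      (54 * (I.map (residue R)).b₆ - 3 * (I.map (residue R)).b₂ * (I.map (residue R)).b₄ +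
        (I.map (residue R)).a₂ * (I.map (residue R)).c₄) ≠ 0 := by
  intro hμ
  apply hns
  have hc₄b : residue R I.c₄ ≠ 0 := by rw [Ne, residue_eq_zero_iff]; exact hc₄
  refine Polynomial.Splits.of_degree_eq_two (x := μ) ?_ ?_
  · rw [Polynomial.map_sub, Polynomial.map_add, Polynomial.map_mul, Polynomial.map_mul,
      Polynomial.map_pow, map_C, map_C, map_C, Polynomial.map_X, sub_eq_add_neg, ← C_neg,
      ResidueField.algebraMap_eq, degree_quadratic hc₄b]
  · rw [eval_map, ResidueField.algebraMap_eq]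
    simp only [eval₂_sub, eval₂_add, eval₂_mul, eval₂_C, eval₂_X, eval₂_pow, eval₂_ofNat,
      map_mul, map_sub, map_add, map_ofNat]
    simp only [WeierstrassCurve.map_c₄, WeierstrassCurve.map_a₁, WeierstrassCurve.map_a₂,
      WeierstrassCurve.map_b₂, WeierstrassCurve.map_b₄, WeierstrassCurve.map_b₆] at hμ
    exact hμ

end LocalIndex

/-! ### The discharge -/

section Discharge

open IsDedekindDomain

variable {A : Type*} [CommRing A] [IsDedekindDomain A] {K : Type*} [Field K] [Algebra A K]
  [IsFractionRing A K] (v : HeightOneSpectrum A) (W : WeierstrassCurve K)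

/-- **Discharge of `localTamagawaNumber_of_hasNonsplitMultiplicativeReductionAt`**: for
multiplicative, non-split reduction at a place with finite residue field, `c_v = 2` if
`ord_v(Δ_min)` is even and `1` otherwise (Silverman, *ATAEC*, IV.9.4 Step 2, PDF p. 344), by
the elementary argument of this file over the Henselian ring `O_v`; non-splitness of Mathlib's
`HasSplitMultiplicativeReduction` means that the node-tangent polynomial, of degree `2`, has no
root in `k` (`Polynomial.Splits.of_degree_eq_two`).
[cite: SilvermanATAEC1994, IV.9.4 Step 2 (PDF p. 344)] -/
theorem localTamagawaNumber_of_hasNonsplitMultiplicativeReductionAt_holds :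
    localTamagawaNumber_of_hasNonsplitMultiplicativeReductionAt v W := by
  intro _ _ hmult hnsplit
  haveI := W.isElliptic_localMinimalModel v
  obtain ⟨hΔm, hc₄m⟩ := (WeierstrassCurve.hasMultiplicativeReductionAt_iff_mem v W).mp hmult
  change ((W.localMinimalModel v).goodReductionSubgroup (v.adicCompletionIntegers K)).index =
    if Even (IsDiscreteValuationRing.addVal (v.adicCompletionIntegers K)
      ((W.localMinimalModel v).integralModel (v.adicCompletionIntegers K)).Δ).toNat then 2 else 1
  have key : ∀ (M : WeierstrassCurve (v.adicCompletion K))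
      [M.IsMinimal (v.adicCompletionIntegers K)] [M.IsElliptic],
      (M.integralModel (v.adicCompletionIntegers K)).Δ ∈
        maximalIdeal (v.adicCompletionIntegers K) →
      (M.integralModel (v.adicCompletionIntegers K)).c₄ ∉
        maximalIdeal (v.adicCompletionIntegers K) →
      ¬ Splits (letI I := M.integralModel (v.adicCompletionIntegers K)
        Polynomial.map (algebraMap (v.adicCompletionIntegers K)
          (ResidueField (v.adicCompletionIntegers K)))
        (C I.c₄ * X ^ 2 + C (I.a₁ * I.c₄) * X - C (54 * I.b₆ - 3 * I.b₂ * I.b₄ + I.a₂ * I.c₄))) →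
        (M.goodReductionSubgroup (v.adicCompletionIntegers K)).index =
          if Even (IsDiscreteValuationRing.addVal (v.adicCompletionIntegers K)
            (M.integralModel (v.adicCompletionIntegers K)).Δ).toNat then 2 else 1 := by
    intro M _ _ hΔ hc₄ hns
    obtain ⟨I, rfl⟩ : ∃ I : WeierstrassCurve (v.adicCompletionIntegers K),
      M = I.baseChange (v.adicCompletion K) := WeierstrassCurve.IsIntegral.integral
    rw [WeierstrassCurve.integralModel_baseChange_eq] at hΔ hc₄ hns ⊢
    rw [WeierstrassCurve.goodReductionSubgroup_baseChange_eq]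
    refine LocalIndex.index_of_nonsplit I ?_ hΔ hc₄ (LocalIndex.noroot_of_not_splits I hc₄ hns)
    intro h0
    apply (I.baseChange (v.adicCompletion K)).Δ'.ne_zero
    rw [WeierstrassCurve.coe_Δ', WeierstrassCurve.baseChange, WeierstrassCurve.map_Δ, h0, map_zero]
  refine key (W.localMinimalModel v) hΔm hc₄m fun hsplit => hnsplit ?_
  haveI : (W.localMinimalModel v).HasMultiplicativeReduction (v.adicCompletionIntegers K) := hmult
  exact ⟨hsplit⟩

end Discharge

end Literature.NumberTheory.EllipticCurves

end
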